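import Literature.AlgebraicGeometry.Resolution.MonoidalTransformFrameStepTracked
import Literature.AlgebraicGeometry.Resolution.PerronTransforms
import HarnessLib

/-!
# [CoP1] Lemma 8.2: Perron's algorithm by monoidal transforms along the valuation, IN THE FRAME

Topic: `Literature/AlgebraicGeometry/Resolution`. PROOF side of `CossartPiltant2019ReductionP`
(`ArithmeticalThreefoldsLocal.lean`), input (C4): the head of the decomposition layer of
[CoP1] Prop. 9.3 is [CoP1] Prop. 8.1 (`DecompositionLayerStrictParameters.lean`,
`exists_localUniformization_of_head'`). After the reduction `E = F`
(`MonoidalEFReduction.lean`) the printed proof of Prop. 8.1 (V. Cossart, O. Piltant,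
HAL hal-00139124, pp. 22–23) lowers `♯E` by **Lemma 8.2**:

> Lemma 8.2. Let `R⁽⁰⁾` be a regular local ring of dimension `d ≥ 2` and r.s.p.
> `(x₁, …, x_d)`. Let `V` be a valuation ring such that `R⁽⁰⁾ < V` … Assume that
> `V x₁, …, V x_r` are linearly independent …, generate an Archimedean subgroup of `V K` and
> that `V x_{r+1} ∈ ⊕ ℚ V xᵢ`. There exists an integer `n ≥ 1`, a sequence of monoidal
> transforms along `V`, `R⁽⁰⁾ < R⁽¹⁾ < ⋯ < R⁽ⁿ⁾`, where … `R⁽ʲ⁾` is the monoidal transform of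
> `R⁽ʲ⁻¹⁾` at `(x_{i_j}, x_{i′_j})` along `V` and: (1) `x_i⁽ʲ⁾ = x_i⁽ʲ⁻¹⁾` for `i ≠ i′_j`;
> (2) for `j ≤ n − 1`, `x_{i′_j}⁽ʲ⁾ = x_{i′_j}⁽ʲ⁻¹⁾ / x_{i_j}⁽ʲ⁻¹⁾`; (3) `V x_{i′_n}⁽ⁿ⁻¹⁾ = V x_{i_n}⁽ⁿ⁻¹⁾`.
> ("The following lemma is an immediate application of the Perron algorithm ([45] theorem 1
> on p. 862).")

This file PROVES the lemma in the frame of `MonoidalTransformFrameStepTracked.lean` (models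
`S[t] ⊆ O_E`, tracked generators `fⁿ t ⊆ R₀`), in the form used on HAL p. 23: starting from a
regular `R_t` with regular parameters `x`, an index set `I` on which `f = u ∏ x^α` is supported
(`I ⊆ supp α`, so that every chart denominator divides `f`, Prop. 8.1 (1)) and a NON-TRIVIAL
MULTIPLICATIVE RELATION `∏_{k ∈ I} v(x_k)^{p_k} = ∏_{k ∈ I} v(x_k)^{m_k}`, `p ≠ m` (this is
"`V x_{r+1} ∈ ⊕ ℚ V xᵢ`"), finitely many monoidal transforms at pairs of indices of `I`, each
in the chart of positive value (so that all monomials are transported to monomials with larger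
exponents, `E` and `F` unchanged), reach a regular `R_{t′}` with regular parameters `x′`,
`x′_k = x_k` off `I`, and two indices `i ≠ i′` in `I` with `v(x′_i) = v(x′_{i′})` — the input of
the unit step `exists_frameStepTracked_of_valuation_eq_one`, which then removes an index from
`E` (HAL p. 23, "`E⁽ⁿ⁾ = F⁽ⁿ⁾ ⊂ E`").

* `exists_frameFanTracked` — the monoidal transforms at `(x_j, x_i)`, `i ∈ J′`, for a common
  pivot `j` of larger value (one move of Perron's algorithm = one blow-up of `(x_k : k ∈ J)`
  localized at the centre of the valuation);
* `exists_frameStepsTracked_valuation_eq` — **Lemma 8.2**, by well-founded induction on the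
  potential of de Moraes–Novacoski attached to the relation `p − m` (`PerronTransforms.lean`,
  `perron_exists_finset`: the engine chooses the centre `J`, the valuation chooses the pivot).

Design note. The termination argument is NOT Zariski's real-number Perron algorithm cited in
print but the order-agnostic engine of Perron transforms / Hironaka's game
(de Moraes–Novacoski 2020, Prop. 2.2), already in the tree; consequently the Archimedean
hypothesis of the printed lemma is not needed for conclusion (3) (a coincidence of two values),
and the relation may be any non-trivial one among the `v(x_k)`, `k ∈ I`.

Everything is PROVED; no named facts, definitions, instances or notation are introduced.

## Sources

* V. Cossart, O. Piltant, J. Algebra 320 (2008) 1051–1082: Lemma 8.2 and the proof of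
  Prop. 8.1 (HAL hal-00139124, pp. 22–23). [CossartPiltant2008]
* M. de Moraes, J. Novacoski, J. Algebra 563 (2020) 100–110: Prop. 2.2. [DemoraesNovacoski2020]
-/

noncomputable section

namespace Literature.AlgebraicGeometry.Resolution

universe u

open IsLocalRing _root_.Polynomial Function

section Perron

variable {S : Type u} [CommRing S] [IsDomain S] [IsLocalRing S] {E : Type u} [Field E]
  [Algebra S E] [Algebra.IsAlgebraic S E]
  (hSuc : IsUniversallyCatenaryRing S) (hinj : Function.Injective (algebraMap S E))
  (O : ValuationSubring E) (hSO : ∀ s : S, algebraMap S E s ∈ O)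
  (hdom : ∀ s ∈ maximalIdeal S, O.valuation (algebraMap S E s) < 1)
  (hres : ∀ y : O, ∃ q : S[X], (∃ i, q.coeff i ∉ maximalIdeal S) ∧
    O.valuation (q.eval₂ (algebraMap S E) y) < 1)

include hSuc hinj hSO hdom hres in
/-- In the frame, the members of a regular system of parameters of `R_t` are nonzero
(`dim R_t = d`, minimality of the `d` generators). [folklore] -/
private theorem coe_rsop_ne_zero {d : ℕ} (hSdim : ringKrullDim S = d) (t : Set E)
    (ht : t.Finite) (hTO : (Algebra.adjoin S t).toSubring ≤ O.toSubring)
    (hreg : IsRegularLocalRing (locAtCentre (Algebra.adjoin S t).toSubring O))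
    (x : Fin d → locAtCentre (Algebra.adjoin S t).toSubring O)
    (hx : haveI := isLocalRing_locAtCentre hTO
      Ideal.span (Set.range x) = maximalIdeal _)
    (k : Fin d) : (x k : E) ≠ 0 := by
  haveI := isLocalRing_locAtCentre hTO
  haveI := hreg
  intro hz
  have hdimR : ringKrullDim (locAtCentre (Algebra.adjoin S t).toSubring O) = d := by
    haveI : Algebra.FiniteType S (Algebra.adjoin S t) := by
      rw [← ht.coe_toFinset]
      exact (Subalgebra.fg_iff_finiteType _).mp (Subalgebra.fg_adjoin_finset _)
    rw [ringKrullDim_locAtCentre_eq_of_frame hSuc hinj O hSO hdom hres (Algebra.adjoin S t) hTO,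
      hSdim]
  have hd : (maximalIdeal (locAtCentre (Algebra.adjoin S t).toSubring O)).spanFinrank = d := by
    have h := IsRegularLocalRing.spanFinrank_maximalIdeal
      (R := locAtCentre (Algebra.adjoin S t).toSubring O)
    rw [hdimR] at h
    exact_mod_cast h
  have hnot : k ∉ (∅ : Set (Fin d)) := Set.notMem_empty _
  have := not_mem_span_image_of_not_mem hd x hx hnot
  rw [Set.image_empty, Ideal.span_empty] at this
  exact this (by rw [show x k = 0 from Subtype.ext hz]; exact Submodule.zero_mem ⊥)

omit [IsDomain S] [IsLocalRing S] [Algebra.IsAlgebraic S E] in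
/-- Larger exponents give a strictly smaller monomial in values lying in `(0, 1)`: if
`m ≤ p` pointwise and `m ≠ p` then `∏ v_k^{p_k} < ∏ v_k^{m_k}`. [folklore] -/
private theorem prod_pow_lt_prod_pow {ι : Type*} [Fintype ι] {Γ₀ : Type*}
    [LinearOrderedCommGroupWithZero Γ₀] (v : ι → Γ₀) (hv0 : ∀ k, v k ≠ 0) (hv1 : ∀ k, v k < 1)
    (p m : ι → ℕ) (hle : ∀ k, m k ≤ p k) (hne : p ≠ m) :
    ∏ k, v k ^ p k < ∏ k, v k ^ m k := by
  classical
  obtain ⟨k₀, hk₀⟩ := Function.ne_iff.mp hne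
  have hk₀' : m k₀ < p k₀ := lt_of_le_of_ne (hle k₀) (Ne.symm hk₀)
  have hsplit : ∏ k, v k ^ p k = (∏ k, v k ^ m k) * ∏ k, v k ^ (p k - m k) := by
    rw [← Finset.prod_mul_distrib]
    refine Finset.prod_congr rfl fun k _ => ?_
    rw [← pow_add, Nat.add_sub_cancel' (hle k)]
  have hlt1 : ∏ k, v k ^ (p k - m k) < 1 := by
    rw [← Finset.mul_prod_erase _ _ (Finset.mem_univ k₀)]
    have h1 : v k₀ ^ (p k₀ - m k₀) < 1 :=
      pow_lt_one₀ zero_le (hv1 k₀) (Nat.sub_ne_zero_of_lt hk₀')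
    have h2 : ∏ k ∈ Finset.univ.erase k₀, v k ^ (p k - m k) ≤ 1 :=
      Finset.prod_le_one' fun k _ => pow_le_one₀ zero_le (hv1 k).le
    calc v k₀ ^ (p k₀ - m k₀) * ∏ k ∈ Finset.univ.erase k₀, v k ^ (p k - m k)
        ≤ v k₀ ^ (p k₀ - m k₀) * 1 := mul_le_mul_right h2 _
      _ < 1 := by rw [mul_one]; exact h1
  have hpos : 0 < ∏ k, v k ^ m k :=
    zero_lt_iff.mpr (Finset.prod_ne_zero_iff.mpr fun k _ => pow_ne_zero _ (hv0 k))
  rw [hsplit]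
  exact mul_lt_of_lt_one_right hpos hlt1

set_option maxHeartbeats 1600000 in
include hSuc hinj hSO hdom hres in
/-- **One move of Perron's algorithm by monoidal transforms** ([CoP1] Lemma 8.2 (1)–(2), HAL
p. 23): for a pivot `j` and indices `J′ ∌ j` with `v(x_i) < v(x_j)` for `i ∈ J′`, the monoidal
transforms at `(x_j, x_i)`, `i ∈ J′`, along `O` (each in the chart `x_i / x_j` of positive
value) lead from the regular `R_t` with regular parameters `x` to a regular `R_{t₁} ⊇ R_t`,
`t ⊆ t₁` with the generator bookkeeping `fⁿ t₁ ⊆ R₀` (when `x_j ∣ f`, i.e. `α_j > 0` in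
`f = u ∏ x^α`), with regular parameters `x₁`, `x₁_i = x_i / x_j` (`i ∈ J′`), `x₁_k = x_k`
otherwise, and `∏ x^γ = ∏ x₁^{γ[j ↦ γ_j + ∑_{i ∈ J′} γ_i]}` for every `γ`.
[cite: CossartPiltant2008, Lemma 8.2 (HAL p. 23)] -/
theorem exists_frameFanTracked {d : ℕ} (hSdim : ringKrullDim S = d)
    (R₀ : Subring E) (hSR₀ : ∀ s : S, algebraMap S E s ∈ R₀) (f : E) (hfR₀ : f ∈ R₀)
    (j : Fin d) (J' : Finset (Fin d)) (hjJ' : j ∉ J') :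
    ∀ (t : Set E) (_ : t.Finite) (_ : ∀ y ∈ t, ∃ n : ℕ, f ^ n * y ∈ R₀)
      (hTO : (Algebra.adjoin S t).toSubring ≤ O.toSubring)
      (_ : IsRegularLocalRing (locAtCentre (Algebra.adjoin S t).toSubring O))
      (x : Fin d → locAtCentre (Algebra.adjoin S t).toSubring O)
      (_ : haveI := isLocalRing_locAtCentre hTO
        Ideal.span (Set.range x) = maximalIdeal _)
      (u : E) (_ : u ∈ locAtCentre (Algebra.adjoin S t).toSubring O) (α : Fin d → ℕ)
      (_ : 0 < α j) (_ : f = u * ∏ c, (x c : E) ^ α c)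
      (_ : ∀ i ∈ J', O.valuation (x i : E) < O.valuation (x j : E)),
    ∃ (t₁ : Set E), t ⊆ t₁ ∧ t₁.Finite ∧ (∀ y ∈ t₁, ∃ n : ℕ, f ^ n * y ∈ R₀) ∧
      ∃ (hT₁O : (Algebra.adjoin S t₁).toSubring ≤ O.toSubring),
        IsRegularLocalRing (locAtCentre (Algebra.adjoin S t₁).toSubring O) ∧
        locAtCentre (Algebra.adjoin S t).toSubring O ≤
          locAtCentre (Algebra.adjoin S t₁).toSubring O ∧
        ∃ x₁ : Fin d → locAtCentre (Algebra.adjoin S t₁).toSubring O,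
          (haveI := isLocalRing_locAtCentre hT₁O
           Ideal.span (Set.range x₁) = maximalIdeal _) ∧
          (∀ k, k ∉ J' → (x₁ k : E) = (x k : E)) ∧
          (∀ i ∈ J', (x₁ i : E) = (x i : E) / (x j : E)) ∧
          ∀ γ : Fin d → ℕ, (∏ c, (x c : E) ^ γ c) =
            ∏ c, (x₁ c : E) ^ update γ j (γ j + ∑ i ∈ J', γ i) c := by
  classical
  induction J' using Finset.induction_on with
  | empty =>
    intro t ht hTR hTO hreg x hx u huR α hαj hf hlt
    refine ⟨t, le_rfl, ht, hTR, hTO, hreg, le_rfl, x, hx, fun k _ => rfl,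
      fun i hi => absurd hi (Finset.notMem_empty _), fun γ => ?_⟩
    simp only [Finset.sum_empty, add_zero, update_eq_self]
  | insert i J₀ hiJ₀ ih =>
    intro t ht hTR hTO hreg x hx u huR α hαj hf hlt
    have hji : j ≠ i := fun h => hjJ' (h ▸ Finset.mem_insert_self _ _)
    have hjJ₀ : j ∉ J₀ := fun h => hjJ' (Finset.mem_insert_of_mem h)
    -- the step at `(x_j, x_i)`, chart `z = x_i / x_j`
    have hvij : O.valuation (x i : E) < O.valuation (x j : E) :=
      hlt i (Finset.mem_insert_self _ _)
    have hvj0 : 0 < O.valuation (x j : E) := lt_of_le_of_lt zero_le hvij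
    have hxj0 : (x j : E) ≠ 0 := fun h => by rw [h, map_zero] at hvj0; exact lt_irrefl _ hvj0
    have hzlt : O.valuation ((x i : E) / (x j : E)) < 1 := by
      rw [map_div₀, div_lt_one₀ hvj0]; exact hvij
    have hzf : (x i : E) / (x j : E) * f ∈ locAtCentre (Algebra.adjoin S t).toSubring O := by
      have hsplit : (∏ c, (x c : E) ^ α c) =
          (x j : E) ^ α j * ∏ c ∈ Finset.univ.erase j, (x c : E) ^ α c :=
        (Finset.mul_prod_erase _ _ (Finset.mem_univ j)).symm
      have hαj' : α j = (α j - 1) + 1 := (Nat.sub_add_cancel hαj).symm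
      have heq : (x i : E) / (x j : E) * f =
          u * (x i : E) * (x j : E) ^ (α j - 1) * ∏ c ∈ Finset.univ.erase j, (x c : E) ^ α c := by
        rw [hf, hsplit]
        conv_lhs => rw [hαj', pow_succ]
        field_simp
      rw [heq]
      refine Subring.mul_mem _ (Subring.mul_mem _ (Subring.mul_mem _ huR (x i).2)
        (Subring.pow_mem _ (x j).2 _)) (Subring.prod_mem _ fun c _ => Subring.pow_mem _ (x c).2 _)
    obtain ⟨t₁, htt₁, ht₁, hTR₁, hT₁O, hreg₁, x', hx'c, hx'b, hspan₁, hmono⟩ :=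
      exists_frameStepTracked_of_valuation_lt_one hSuc hinj O hSO hdom hres hSdim R₀ hSR₀ f hfR₀
        t ht hTR hTO hreg x hx j i hji hzlt hzf
    have hsub₁ : locAtCentre (Algebra.adjoin S t).toSubring O ≤
        locAtCentre (Algebra.adjoin S t₁).toSubring O :=
      locAtCentre_mono O (fun y hy => Algebra.adjoin_mono htt₁ hy)
    -- the remaining moves, from the new state
    obtain ⟨t₂, ht₁t₂, ht₂, hTR₂, hT₂O, hreg₂, hsub₂, x₂, hspan₂, hx₂off, hx₂on, hmono₂⟩ :=
      ih hjJ₀ t₁ ht₁ hTR₁ hT₁O hreg₁ x' hspan₁ u (hsub₁ huR) (update α j (α j + α i))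
        (by rw [update_self]; exact Nat.add_pos_left hαj _) (by rw [hf, hmono α])
        (fun k hk => by
          have hki : k ≠ i := fun h => hiJ₀ (h ▸ hk)
          rw [hx'c k hki, hx'c j hji]
          exact hlt k (Finset.mem_insert_of_mem hk))
    refine ⟨t₂, htt₁.trans ht₁t₂, ht₂, hTR₂, hT₂O, hreg₂, hsub₁.trans hsub₂, x₂, hspan₂,
      fun k hk => ?_, fun k hk => ?_, fun γ => ?_⟩
    · have hki : k ≠ i := fun h => hk (h ▸ Finset.mem_insert_self _ _)
      have hkJ₀ : k ∉ J₀ := fun h => hk (Finset.mem_insert_of_mem h)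
      rw [hx₂off k hkJ₀, hx'c k hki]
    · rcases Finset.mem_insert.mp hk with rfl | hk
      · rw [hx₂off k hiJ₀, hx'b]
      · have hki : k ≠ i := fun h => hiJ₀ (h ▸ hk)
        rw [hx₂on k hk, hx'c k hki, hx'c j hji]
    · have hupd : update (update γ j (γ j + γ i)) j
          (update γ j (γ j + γ i) j + ∑ l ∈ J₀, update γ j (γ j + γ i) l) =
          update γ j (γ j + ∑ l ∈ insert i J₀, γ l) := by
        funext k
        by_cases hkj : k = j
        · subst hkj
          rw [update_self, update_self, update_self, Finset.sum_insert hiJ₀]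
          have : ∀ l ∈ J₀, update γ k (γ k + γ i) l = γ l := fun l hl =>
            update_of_ne (fun (h : l = k) => hjJ₀ (h ▸ hl)) _ _
          rw [Finset.sum_congr rfl this]
          ring
        · rw [update_of_ne hkj, update_of_ne hkj, update_of_ne hkj]
      rw [hmono γ, hmono₂, hupd]

set_option maxHeartbeats 1600000 in
include hSuc hinj hSO hdom hres in
/-- **[CoP1] Lemma 8.2 (Perron's algorithm by monoidal transforms along the valuation), in
the frame.** Let `R_t = locAtCentre S[t] O` be regular with regular parameters `x`
(`fⁿ t ⊆ R₀`, `f = u ∏ x^α`), `I` a set of indices with `α_k > 0` on `I`, and suppose the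
values `v(x_k)`, `k ∈ I`, satisfy a non-trivial multiplicative relation
`∏ v(x_k)^{p_k} = ∏ v(x_k)^{m_k}` (`c = p − m ≠ 0` supported on `I`; printed hypothesis:
"`V x_{r+1} ∈ ⊕ᵢ ℚ V xᵢ`"). Then finitely many monoidal transforms along `O` at pairs
`(x_{i_j}, x_{i′_j})` of indices of `I`, each in the chart of positive value
`x_{i′} ↦ x_{i′}/x_{i}` (conclusions (1)–(2) of the lemma), lead to a regular `R_{t′} ⊇ R_t`,
`t ⊆ t′`, `fⁿ t′ ⊆ R₀`, with regular parameters `x′`, `x′_k = x_k` off `I`, all monomials in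
`x` being monomials in `x′` with larger exponents (unchanged off `I`), and two indices
`i ≠ i′` of `I` with `v(x′_i) = v(x′_{i′})` (conclusion (3)). The induction is on the
de Moraes–Novacoski potential of `c` (`perron_exists_finset`).
[cite: CossartPiltant2008, Lemma 8.2 (HAL p. 23)] -/
theorem exists_frameStepsTracked_valuation_eq {d : ℕ} (hSdim : ringKrullDim S = d)
    (R₀ : Subring E) (hSR₀ : ∀ s : S, algebraMap S E s ∈ R₀) (f : E) (hfR₀ : f ∈ R₀)
    (I : Finset (Fin d)) (q : ℕ ×ₗ ℕ) :
    ∀ (t : Set E) (_ : t.Finite) (_ : ∀ y ∈ t, ∃ n : ℕ, f ^ n * y ∈ R₀)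
      (hTO : (Algebra.adjoin S t).toSubring ≤ O.toSubring)
      (_ : IsRegularLocalRing (locAtCentre (Algebra.adjoin S t).toSubring O))
      (x : Fin d → locAtCentre (Algebra.adjoin S t).toSubring O)
      (_ : haveI := isLocalRing_locAtCentre hTO
        Ideal.span (Set.range x) = maximalIdeal _)
      (u : E) (_ : u ∈ locAtCentre (Algebra.adjoin S t).toSubring O) (α : Fin d → ℕ)
      (_ : ∀ k ∈ I, 0 < α k) (_ : f = u * ∏ c, (x c : E) ^ α c)
      (p m : Fin d → ℕ) (c : Fin d → ℤ) (_ : ∀ k, c k = (p k : ℤ) - m k)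
      (_ : ∀ k, k ∉ I → c k = 0) (_ : c ≠ 0)
      (_ : ∏ k, O.valuation (x k : E) ^ p k = ∏ k, O.valuation (x k : E) ^ m k)
      (_ : toLex (min (∑ k, (c k).toNat) (∑ k, (-c k).toNat),
          max (∑ k, (c k).toNat) (∑ k, (-c k).toNat)) = q),
    ∃ (t' : Set E), t ⊆ t' ∧ t'.Finite ∧ (∀ y ∈ t', ∃ n : ℕ, f ^ n * y ∈ R₀) ∧
      ∃ (hT'O : (Algebra.adjoin S t').toSubring ≤ O.toSubring),
        IsRegularLocalRing (locAtCentre (Algebra.adjoin S t').toSubring O) ∧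
        locAtCentre (Algebra.adjoin S t).toSubring O ≤
          locAtCentre (Algebra.adjoin S t').toSubring O ∧
        ∃ x' : Fin d → locAtCentre (Algebra.adjoin S t').toSubring O,
          (haveI := isLocalRing_locAtCentre hT'O
           Ideal.span (Set.range x') = maximalIdeal _) ∧
          (∀ k, k ∉ I → (x' k : E) = (x k : E)) ∧
          (∃ T : (Fin d → ℕ) → (Fin d → ℕ),
            (∀ γ, (∏ c, (x c : E) ^ γ c) = ∏ c, (x' c : E) ^ T γ c) ∧
            (∀ γ k, γ k ≤ T γ k) ∧ (∀ γ k, k ∉ I → T γ k = γ k)) ∧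
          ∃ i ∈ I, ∃ i' ∈ I, i ≠ i' ∧ O.valuation (x' i : E) = O.valuation (x' i' : E) := by
  classical
  induction q using WellFoundedLT.induction with
  | ind q ih =>
  intro t ht hTR hTO hreg x hx u huR α hIα hf p m c hc hcI hc0 hrel hq
  haveI := isLocalRing_locAtCentre hTO
  -- all parameters have value in `(0, 1)`
  have hv1 : ∀ k, O.valuation (x k : E) < 1 := fun k =>
    (mem_maximalIdeal_locAtCentre_iff hTO _).mp (hx ▸ Ideal.subset_span ⟨k, rfl⟩)
  have hv0 : ∀ k, O.valuation (x k : E) ≠ 0 := fun k h =>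
    coe_rsop_ne_zero hSuc hinj O hSO hdom hres hSdim t ht hTO hreg x hx k
      ((Valuation.zero_iff _).mp h)
  have hpm : p ≠ m := by
    intro h
    apply hc0
    funext k
    rw [hc k, h, sub_self]
    rfl
  -- both masses of the relation are positive (all values lie in `(0, 1)`)
  have hP : 0 < ∑ k, (c k).toNat := by
    by_contra h0
    have h0' : ∑ k, (c k).toNat = 0 := Nat.eq_zero_of_not_pos h0
    have hle : ∀ k, p k ≤ m k := fun k => by
      have h1 := (Finset.sum_eq_zero_iff.mp h0') k (Finset.mem_univ k)
      rw [Int.toNat_eq_zero, hc k] at h1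
      omega
    have := prod_pow_lt_prod_pow (fun k => O.valuation (x k : E)) hv0 hv1 m p hle (Ne.symm hpm)
    rw [hrel] at this
    exact lt_irrefl _ this
  have hN : 0 < ∑ k, (-c k).toNat := by
    by_contra h0
    have h0' : ∑ k, (-c k).toNat = 0 := Nat.eq_zero_of_not_pos h0
    have hle : ∀ k, m k ≤ p k := fun k => by
      have h1 := (Finset.sum_eq_zero_iff.mp h0') k (Finset.mem_univ k)
      rw [Int.toNat_eq_zero, hc k] at h1
      omega
    have := prod_pow_lt_prod_pow (fun k => O.valuation (x k : E)) hv0 hv1 p m hle hpm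
    rw [hrel] at this
    exact lt_irrefl _ this
  obtain ⟨J, hJne, hJ⟩ := perron_exists_finset c hP hN
  -- the relation lives on `I`: restrict the centre to `J ∩ I`
  have hsumJ : ∑ k ∈ J ∩ I, c k = ∑ k ∈ J, c k :=
    Finset.sum_subset Finset.inter_subset_left fun k hkJ hk =>
      hcI k (fun hkI => hk (Finset.mem_inter.mpr ⟨hkJ, hkI⟩))
  have hJ₁ne : (J ∩ I).Nonempty := by
    by_contra hempty
    rw [Finset.not_nonempty_iff_eq_empty] at hempty
    obtain ⟨j, hj⟩ := hJne
    have hsum0 : ∑ k ∈ J, c k = 0 := by rw [← hsumJ, hempty, Finset.sum_empty]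
    have hjI : j ∉ I := fun h =>
      (Finset.notMem_empty j) (hempty ▸ Finset.mem_inter.mpr ⟨hj, h⟩)
    have hupd : update c j (∑ k ∈ J, c k) = c := by
      rw [hsum0, ← hcI j hjI, update_eq_self]
    have := hJ j hj
    rw [hupd] at this
    exact lt_irrefl _ this
  -- the pivot: an index of `J ∩ I` of largest value (the valuation chooses the chart)
  obtain ⟨j, hjJ₁, hjmax⟩ := (J ∩ I).exists_max_image (fun k => O.valuation (x k : E)) hJ₁ne
  have hjJ : j ∈ J := (Finset.mem_inter.mp hjJ₁).1
  have hjI : j ∈ I := (Finset.mem_inter.mp hjJ₁).2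
  by_cases hterm : ∃ i ∈ J ∩ I, i ≠ j ∧ O.valuation (x i : E) = O.valuation (x j : E)
  · -- conclusion (3) is already reached
    obtain ⟨i, hiJ₁, hij, hvi⟩ := hterm
    exact ⟨t, le_rfl, ht, hTR, hTO, hreg, le_rfl, x, hx, fun k _ => rfl,
      ⟨id, fun γ => rfl, fun γ k => le_rfl, fun γ k _ => rfl⟩,
      i, (Finset.mem_inter.mp hiJ₁).2, j, hjI, hij, hvi⟩
  · -- one move: the monoidal transforms at `(x_j, x_i)`, `i ∈ (J ∩ I) ∖ {j}`
    push Not at hterm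
    have hlt : ∀ i ∈ (J ∩ I).erase j, O.valuation (x i : E) < O.valuation (x j : E) :=
      fun i hi => by
        obtain ⟨hij, hiJ₁⟩ := Finset.mem_erase.mp hi
        exact lt_of_le_of_ne (hjmax i hiJ₁) (hterm i hiJ₁ hij)
    obtain ⟨t₁, htt₁, ht₁, hTR₁, hT₁O, hreg₁, hsub₁, x₁, hspan₁, hx₁off, -, hmono₁⟩ :=
      exists_frameFanTracked hSuc hinj O hSO hdom hres hSdim R₀ hSR₀ f hfR₀ j ((J ∩ I).erase j)
        (Finset.notMem_erase j _) t ht hTR hTO hreg x hx u huR α (hIα j hjI) hf hlt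
    -- the exponent transport of this move
    obtain ⟨T₁, hT₁⟩ : ∃ T : (Fin d → ℕ) → (Fin d → ℕ),
        ∀ γ, T γ = update γ j (γ j + ∑ i ∈ (J ∩ I).erase j, γ i) := ⟨_, fun _ => rfl⟩
    have hT₁off : ∀ γ k, k ≠ j → T₁ γ k = γ k := fun γ k hk => by
      rw [hT₁, update_of_ne hk]
    have hT₁j : ∀ γ, T₁ γ j = γ j + ∑ i ∈ (J ∩ I).erase j, γ i := fun γ => by
      rw [hT₁, update_self]
    have hT₁mono : ∀ γ k, γ k ≤ T₁ γ k := fun γ k => by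
      by_cases hk : k = j
      · subst hk; rw [hT₁j]; exact Nat.le_add_right _ _
      · rw [hT₁off γ k hk]
    have hmono₁' : ∀ γ, (∏ c, (x c : E) ^ γ c) = ∏ c, (x₁ c : E) ^ T₁ γ c := fun γ => by
      rw [hT₁]; exact hmono₁ γ
    -- the new relation, its vector `c₁ = update c j (∑_J c)` and support
    have hvmono : ∀ γ, ∏ k, O.valuation (x k : E) ^ γ k =
        ∏ k, O.valuation (x₁ k : E) ^ T₁ γ k := fun γ => by
      have h := congr_arg O.valuation (hmono₁' γ)
      simpa only [map_prod, map_pow] using h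
    have hrel₁ : ∏ k, O.valuation (x₁ k : E) ^ T₁ p k =
        ∏ k, O.valuation (x₁ k : E) ^ T₁ m k := by
      rw [← hvmono p, ← hvmono m]; exact hrel
    have hc₁ : ∀ k, update c j (∑ k ∈ J, c k) k = (T₁ p k : ℤ) - T₁ m k := fun k => by
      by_cases hk : k = j
      · subst hk
        rw [update_self, hT₁j, hT₁j, ← hsumJ, ← Finset.add_sum_erase _ _ hjJ₁, hc,
          Finset.sum_congr rfl fun i _ => hc i]
        push_cast
        rw [Finset.sum_sub_distrib]
        ring
      · rw [update_of_ne hk, hT₁off p k hk, hT₁off m k hk, hc k]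
    have hcI₁ : ∀ k, k ∉ I → update c j (∑ k ∈ J, c k) k = 0 := fun k hk => by
      have hkj : k ≠ j := fun h => hk (h ▸ hjI)
      rw [update_of_ne hkj, hcI k hk]
    have hc0₁ : update c j (∑ k ∈ J, c k) ≠ 0 := by
      intro heq
      apply hc0
      have hoff : ∀ k, k ≠ j → c k = 0 := fun k hk => by
        have := congr_fun heq k
        rwa [update_of_ne hk] at this
      funext k
      by_cases hk : k = j
      · subst hk
        have h1 := congr_fun heq k
        rw [update_self, ← hsumJ, ← Finset.add_sum_erase _ _ hjJ₁,
          Finset.sum_eq_zero (fun i hi => hoff i (Finset.mem_erase.mp hi).1), add_zero] at h1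
        exact h1
      · exact hoff k hk
    -- the potential went down: induction
    have hlt_pot := hJ j hjJ
    rw [hq] at hlt_pot
    obtain ⟨t₂, ht₁t₂, ht₂, hTR₂, hT₂O, hreg₂, hsub₂, x₂, hspan₂, hx₂off, ⟨T₂, hT₂mono', hT₂le,
      hT₂off⟩, i, hiI, i', hi'I, hii', hvii'⟩ :=
      ih _ hlt_pot t₁ ht₁ hTR₁ hT₁O hreg₁ x₁ hspan₁ u (hsub₁ huR) (T₁ α)
        (fun k hk => lt_of_lt_of_le (hIα k hk) (hT₁mono α k)) (by rw [hf, hmono₁' α])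
        (T₁ p) (T₁ m) (update c j (∑ k ∈ J, c k)) hc₁ hcI₁ hc0₁ hrel₁ rfl
    refine ⟨t₂, htt₁.trans ht₁t₂, ht₂, hTR₂, hT₂O, hreg₂, hsub₁.trans hsub₂, x₂, hspan₂,
      fun k hk => ?_, ⟨fun γ => T₂ (T₁ γ), fun γ => ?_, fun γ k => ?_, fun γ k hk => ?_⟩,
      i, hiI, i', hi'I, hii', hvii'⟩
    · have hk' : k ∉ (J ∩ I).erase j := fun h =>
        hk (Finset.mem_inter.mp (Finset.mem_erase.mp h).2).2
      rw [hx₂off k hk, hx₁off k hk']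
    · show (∏ c, (x c : E) ^ γ c) = ∏ c, (x₂ c : E) ^ T₂ (T₁ γ) c
      rw [hmono₁' γ, hT₂mono' (T₁ γ)]
    · show γ k ≤ T₂ (T₁ γ) k
      exact (hT₁mono γ k).trans (hT₂le (T₁ γ) k)
    · show T₂ (T₁ γ) k = γ k
      have hkj : k ≠ j := fun h => hk (h ▸ hjI)
      rw [hT₂off (T₁ γ) k hk, hT₁off γ k hkj]

/-! ### The same, confined to a subfield (for `t′ ⊆ K′` in the head of [CoP1] Prop. 9.3) -/

set_option maxHeartbeats 1600000 in
include hSuc hinj hSO hdom hres in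
/-- `exists_frameFanTracked`, with the new generators confined to a subfield `F ⊇ S ∪ t`.
[cite: CossartPiltant2008, Lemma 8.2 (HAL p. 23)] -/
theorem exists_frameFanTracked_subset {d : ℕ} (hSdim : ringKrullDim S = d)
    (R₀ : Subring E) (hSR₀ : ∀ s : S, algebraMap S E s ∈ R₀) (f : E) (hfR₀ : f ∈ R₀)
    (F : Subfield E) (hSF : ∀ s : S, algebraMap S E s ∈ F)
    (j : Fin d) (J' : Finset (Fin d)) (hjJ' : j ∉ J') :
    ∀ (t : Set E) (_ : t.Finite) (_ : t ⊆ F) (_ : ∀ y ∈ t, ∃ n : ℕ, f ^ n * y ∈ R₀)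
      (hTO : (Algebra.adjoin S t).toSubring ≤ O.toSubring)
      (_ : IsRegularLocalRing (locAtCentre (Algebra.adjoin S t).toSubring O))
      (x : Fin d → locAtCentre (Algebra.adjoin S t).toSubring O)
      (_ : haveI := isLocalRing_locAtCentre hTO
        Ideal.span (Set.range x) = maximalIdeal _)
      (u : E) (_ : u ∈ locAtCentre (Algebra.adjoin S t).toSubring O) (α : Fin d → ℕ)
      (_ : 0 < α j) (_ : f = u * ∏ c, (x c : E) ^ α c)
      (_ : ∀ i ∈ J', O.valuation (x i : E) < O.valuation (x j : E)),
    ∃ (t₁ : Set E), t ⊆ t₁ ∧ t₁.Finite ∧ t₁ ⊆ F ∧ (∀ y ∈ t₁, ∃ n : ℕ, f ^ n * y ∈ R₀) ∧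
      ∃ (hT₁O : (Algebra.adjoin S t₁).toSubring ≤ O.toSubring),
        IsRegularLocalRing (locAtCentre (Algebra.adjoin S t₁).toSubring O) ∧
        locAtCentre (Algebra.adjoin S t).toSubring O ≤
          locAtCentre (Algebra.adjoin S t₁).toSubring O ∧
        ∃ x₁ : Fin d → locAtCentre (Algebra.adjoin S t₁).toSubring O,
          (haveI := isLocalRing_locAtCentre hT₁O
           Ideal.span (Set.range x₁) = maximalIdeal _) ∧
          (∀ k, k ∉ J' → (x₁ k : E) = (x k : E)) ∧
          (∀ i ∈ J', (x₁ i : E) = (x i : E) / (x j : E)) ∧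
          ∀ γ : Fin d → ℕ, (∏ c, (x c : E) ^ γ c) =
            ∏ c, (x₁ c : E) ^ update γ j (γ j + ∑ i ∈ J', γ i) c := by
  classical
  induction J' using Finset.induction_on with
  | empty =>
    intro t ht htF hTR hTO hreg x hx u huR α hαj hf hlt
    refine ⟨t, le_rfl, ht, htF, hTR, hTO, hreg, le_rfl, x, hx, fun k _ => rfl,
      fun i hi => absurd hi (Finset.notMem_empty _), fun γ => ?_⟩
    simp only [Finset.sum_empty, add_zero, update_eq_self]
  | insert i J₀ hiJ₀ ih =>
    intro t ht htF hTR hTO hreg x hx u huR α hαj hf hlt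
    have hji : j ≠ i := fun h => hjJ' (h ▸ Finset.mem_insert_self _ _)
    have hjJ₀ : j ∉ J₀ := fun h => hjJ' (Finset.mem_insert_of_mem h)
    -- the step at `(x_j, x_i)`, chart `z = x_i / x_j`
    have hvij : O.valuation (x i : E) < O.valuation (x j : E) :=
      hlt i (Finset.mem_insert_self _ _)
    have hvj0 : 0 < O.valuation (x j : E) := lt_of_le_of_lt zero_le hvij
    have hxj0 : (x j : E) ≠ 0 := fun h => by rw [h, map_zero] at hvj0; exact lt_irrefl _ hvj0
    have hzlt : O.valuation ((x i : E) / (x j : E)) < 1 := by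
      rw [map_div₀, div_lt_one₀ hvj0]; exact hvij
    have hzf : (x i : E) / (x j : E) * f ∈ locAtCentre (Algebra.adjoin S t).toSubring O := by
      have hsplit : (∏ c, (x c : E) ^ α c) =
          (x j : E) ^ α j * ∏ c ∈ Finset.univ.erase j, (x c : E) ^ α c :=
        (Finset.mul_prod_erase _ _ (Finset.mem_univ j)).symm
      have hαj' : α j = (α j - 1) + 1 := (Nat.sub_add_cancel hαj).symm
      have heq : (x i : E) / (x j : E) * f =
          u * (x i : E) * (x j : E) ^ (α j - 1) * ∏ c ∈ Finset.univ.erase j, (x c : E) ^ α c := by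
        rw [hf, hsplit]
        conv_lhs => rw [hαj', pow_succ]
        field_simp
      rw [heq]
      refine Subring.mul_mem _ (Subring.mul_mem _ (Subring.mul_mem _ huR (x i).2)
        (Subring.pow_mem _ (x j).2 _)) (Subring.prod_mem _ fun c _ => Subring.pow_mem _ (x c).2 _)
    obtain ⟨t₁, htt₁, ht₁, ht₁F, hTR₁, hT₁O, hreg₁, x', hx'c, hx'b, hspan₁, hmono⟩ :=
      exists_frameStepTracked_of_valuation_lt_one_subset hSuc hinj O hSO hdom hres hSdim R₀ hSR₀ f
        hfR₀ F hSF t ht htF hTR hTO hreg x hx j i hji hzlt hzf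
    have hsub₁ : locAtCentre (Algebra.adjoin S t).toSubring O ≤
        locAtCentre (Algebra.adjoin S t₁).toSubring O :=
      locAtCentre_mono O (fun y hy => Algebra.adjoin_mono htt₁ hy)
    -- the remaining moves, from the new state
    obtain ⟨t₂, ht₁t₂, ht₂, ht₂F, hTR₂, hT₂O, hreg₂, hsub₂, x₂, hspan₂, hx₂off, hx₂on, hmono₂⟩ :=
      ih hjJ₀ t₁ ht₁ ht₁F hTR₁ hT₁O hreg₁ x' hspan₁ u (hsub₁ huR) (update α j (α j + α i))
        (by rw [update_self]; exact Nat.add_pos_left hαj _) (by rw [hf, hmono α])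
        (fun k hk => by
          have hki : k ≠ i := fun h => hiJ₀ (h ▸ hk)
          rw [hx'c k hki, hx'c j hji]
          exact hlt k (Finset.mem_insert_of_mem hk))
    refine ⟨t₂, htt₁.trans ht₁t₂, ht₂, ht₂F, hTR₂, hT₂O, hreg₂, hsub₁.trans hsub₂, x₂, hspan₂,
      fun k hk => ?_, fun k hk => ?_, fun γ => ?_⟩
    · have hki : k ≠ i := fun h => hk (h ▸ Finset.mem_insert_self _ _)
      have hkJ₀ : k ∉ J₀ := fun h => hk (Finset.mem_insert_of_mem h)
      rw [hx₂off k hkJ₀, hx'c k hki]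
    · rcases Finset.mem_insert.mp hk with rfl | hk
      · rw [hx₂off k hiJ₀, hx'b]
      · have hki : k ≠ i := fun h => hiJ₀ (h ▸ hk)
        rw [hx₂on k hk, hx'c k hki, hx'c j hji]
    · have hupd : update (update γ j (γ j + γ i)) j
          (update γ j (γ j + γ i) j + ∑ l ∈ J₀, update γ j (γ j + γ i) l) =
          update γ j (γ j + ∑ l ∈ insert i J₀, γ l) := by
        funext k
        by_cases hkj : k = j
        · subst hkj
          rw [update_self, update_self, update_self, Finset.sum_insert hiJ₀]
          have : ∀ l ∈ J₀, update γ k (γ k + γ i) l = γ l := fun l hl =>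
            update_of_ne (fun (h : l = k) => hjJ₀ (h ▸ hl)) _ _
          rw [Finset.sum_congr rfl this]
          ring
        · rw [update_of_ne hkj, update_of_ne hkj, update_of_ne hkj]
      rw [hmono γ, hmono₂, hupd]

set_option maxHeartbeats 1600000 in
include hSuc hinj hSO hdom hres in
/-- `exists_frameStepsTracked_valuation_eq` ([CoP1] Lemma 8.2 in the frame), with the new
generators confined to a subfield `F ⊇ S ∪ t`. [cite: CossartPiltant2008, Lemma 8.2 (HAL p. 23)] -/
theorem exists_frameStepsTracked_valuation_eq_subset {d : ℕ} (hSdim : ringKrullDim S = d)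
    (R₀ : Subring E) (hSR₀ : ∀ s : S, algebraMap S E s ∈ R₀) (f : E) (hfR₀ : f ∈ R₀)
    (F : Subfield E) (hSF : ∀ s : S, algebraMap S E s ∈ F)
    (I : Finset (Fin d)) (q : ℕ ×ₗ ℕ) :
    ∀ (t : Set E) (_ : t.Finite) (_ : t ⊆ F) (_ : ∀ y ∈ t, ∃ n : ℕ, f ^ n * y ∈ R₀)
      (hTO : (Algebra.adjoin S t).toSubring ≤ O.toSubring)
      (_ : IsRegularLocalRing (locAtCentre (Algebra.adjoin S t).toSubring O))
      (x : Fin d → locAtCentre (Algebra.adjoin S t).toSubring O)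
      (_ : haveI := isLocalRing_locAtCentre hTO
        Ideal.span (Set.range x) = maximalIdeal _)
      (u : E) (_ : u ∈ locAtCentre (Algebra.adjoin S t).toSubring O) (α : Fin d → ℕ)
      (_ : ∀ k ∈ I, 0 < α k) (_ : f = u * ∏ c, (x c : E) ^ α c)
      (p m : Fin d → ℕ) (c : Fin d → ℤ) (_ : ∀ k, c k = (p k : ℤ) - m k)
      (_ : ∀ k, k ∉ I → c k = 0) (_ : c ≠ 0)
      (_ : ∏ k, O.valuation (x k : E) ^ p k = ∏ k, O.valuation (x k : E) ^ m k)
      (_ : toLex (min (∑ k, (c k).toNat) (∑ k, (-c k).toNat),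
          max (∑ k, (c k).toNat) (∑ k, (-c k).toNat)) = q),
    ∃ (t' : Set E), t ⊆ t' ∧ t'.Finite ∧ t' ⊆ F ∧ (∀ y ∈ t', ∃ n : ℕ, f ^ n * y ∈ R₀) ∧
      ∃ (hT'O : (Algebra.adjoin S t').toSubring ≤ O.toSubring),
        IsRegularLocalRing (locAtCentre (Algebra.adjoin S t').toSubring O) ∧
        locAtCentre (Algebra.adjoin S t).toSubring O ≤
          locAtCentre (Algebra.adjoin S t').toSubring O ∧
        ∃ x' : Fin d → locAtCentre (Algebra.adjoin S t').toSubring O,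
          (haveI := isLocalRing_locAtCentre hT'O
           Ideal.span (Set.range x') = maximalIdeal _) ∧
          (∀ k, k ∉ I → (x' k : E) = (x k : E)) ∧
          (∃ T : (Fin d → ℕ) → (Fin d → ℕ),
            (∀ γ, (∏ c, (x c : E) ^ γ c) = ∏ c, (x' c : E) ^ T γ c) ∧
            (∀ γ k, γ k ≤ T γ k) ∧ (∀ γ k, k ∉ I → T γ k = γ k)) ∧
          ∃ i ∈ I, ∃ i' ∈ I, i ≠ i' ∧ O.valuation (x' i : E) = O.valuation (x' i' : E) := by
  classical
  induction q using WellFoundedLT.induction with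
  | ind q ih =>
  intro t ht htF hTR hTO hreg x hx u huR α hIα hf p m c hc hcI hc0 hrel hq
  haveI := isLocalRing_locAtCentre hTO
  -- all parameters have value in `(0, 1)`
  have hv1 : ∀ k, O.valuation (x k : E) < 1 := fun k =>
    (mem_maximalIdeal_locAtCentre_iff hTO _).mp (hx ▸ Ideal.subset_span ⟨k, rfl⟩)
  have hv0 : ∀ k, O.valuation (x k : E) ≠ 0 := fun k h =>
    coe_rsop_ne_zero hSuc hinj O hSO hdom hres hSdim t ht hTO hreg x hx k
      ((Valuation.zero_iff _).mp h)
  have hpm : p ≠ m := by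
    intro h
    apply hc0
    funext k
    rw [hc k, h, sub_self]
    rfl
  -- both masses of the relation are positive (all values lie in `(0, 1)`)
  have hP : 0 < ∑ k, (c k).toNat := by
    by_contra h0
    have h0' : ∑ k, (c k).toNat = 0 := Nat.eq_zero_of_not_pos h0
    have hle : ∀ k, p k ≤ m k := fun k => by
      have h1 := (Finset.sum_eq_zero_iff.mp h0') k (Finset.mem_univ k)
      rw [Int.toNat_eq_zero, hc k] at h1
      omega
    have := prod_pow_lt_prod_pow (fun k => O.valuation (x k : E)) hv0 hv1 m p hle (Ne.symm hpm)
    rw [hrel] at this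
    exact lt_irrefl _ this
  have hN : 0 < ∑ k, (-c k).toNat := by
    by_contra h0
    have h0' : ∑ k, (-c k).toNat = 0 := Nat.eq_zero_of_not_pos h0
    have hle : ∀ k, m k ≤ p k := fun k => by
      have h1 := (Finset.sum_eq_zero_iff.mp h0') k (Finset.mem_univ k)
      rw [Int.toNat_eq_zero, hc k] at h1
      omega
    have := prod_pow_lt_prod_pow (fun k => O.valuation (x k : E)) hv0 hv1 p m hle hpm
    rw [hrel] at this
    exact lt_irrefl _ this
  obtain ⟨J, hJne, hJ⟩ := perron_exists_finset c hP hN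
  -- the relation lives on `I`: restrict the centre to `J ∩ I`
  have hsumJ : ∑ k ∈ J ∩ I, c k = ∑ k ∈ J, c k :=
    Finset.sum_subset Finset.inter_subset_left fun k hkJ hk =>
      hcI k (fun hkI => hk (Finset.mem_inter.mpr ⟨hkJ, hkI⟩))
  have hJ₁ne : (J ∩ I).Nonempty := by
    by_contra hempty
    rw [Finset.not_nonempty_iff_eq_empty] at hempty
    obtain ⟨j, hj⟩ := hJne
    have hsum0 : ∑ k ∈ J, c k = 0 := by rw [← hsumJ, hempty, Finset.sum_empty]
    have hjI : j ∉ I := fun h =>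
      (Finset.notMem_empty j) (hempty ▸ Finset.mem_inter.mpr ⟨hj, h⟩)
    have hupd : update c j (∑ k ∈ J, c k) = c := by
      rw [hsum0, ← hcI j hjI, update_eq_self]
    have := hJ j hj
    rw [hupd] at this
    exact lt_irrefl _ this
  -- the pivot: an index of `J ∩ I` of largest value (the valuation chooses the chart)
  obtain ⟨j, hjJ₁, hjmax⟩ := (J ∩ I).exists_max_image (fun k => O.valuation (x k : E)) hJ₁ne
  have hjJ : j ∈ J := (Finset.mem_inter.mp hjJ₁).1
  have hjI : j ∈ I := (Finset.mem_inter.mp hjJ₁).2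
  by_cases hterm : ∃ i ∈ J ∩ I, i ≠ j ∧ O.valuation (x i : E) = O.valuation (x j : E)
  · -- conclusion (3) is already reached
    obtain ⟨i, hiJ₁, hij, hvi⟩ := hterm
    exact ⟨t, le_rfl, ht, htF, hTR, hTO, hreg, le_rfl, x, hx, fun k _ => rfl,
      ⟨id, fun γ => rfl, fun γ k => le_rfl, fun γ k _ => rfl⟩,
      i, (Finset.mem_inter.mp hiJ₁).2, j, hjI, hij, hvi⟩
  · -- one move: the monoidal transforms at `(x_j, x_i)`, `i ∈ (J ∩ I) ∖ {j}`
    push Not at hterm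
    have hlt : ∀ i ∈ (J ∩ I).erase j, O.valuation (x i : E) < O.valuation (x j : E) :=
      fun i hi => by
        obtain ⟨hij, hiJ₁⟩ := Finset.mem_erase.mp hi
        exact lt_of_le_of_ne (hjmax i hiJ₁) (hterm i hiJ₁ hij)
    obtain ⟨t₁, htt₁, ht₁, ht₁F, hTR₁, hT₁O, hreg₁, hsub₁, x₁, hspan₁, hx₁off, -, hmono₁⟩ :=
      exists_frameFanTracked_subset hSuc hinj O hSO hdom hres hSdim R₀ hSR₀ f hfR₀ F hSF j
        ((J ∩ I).erase j) (Finset.notMem_erase j _) t ht htF hTR hTO hreg x hx u huR α (hIα j hjI)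
        hf hlt
    -- the exponent transport of this move
    obtain ⟨T₁, hT₁⟩ : ∃ T : (Fin d → ℕ) → (Fin d → ℕ),
        ∀ γ, T γ = update γ j (γ j + ∑ i ∈ (J ∩ I).erase j, γ i) := ⟨_, fun _ => rfl⟩
    have hT₁off : ∀ γ k, k ≠ j → T₁ γ k = γ k := fun γ k hk => by
      rw [hT₁, update_of_ne hk]
    have hT₁j : ∀ γ, T₁ γ j = γ j + ∑ i ∈ (J ∩ I).erase j, γ i := fun γ => by
      rw [hT₁, update_self]
    have hT₁mono : ∀ γ k, γ k ≤ T₁ γ k := fun γ k => by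
      by_cases hk : k = j
      · subst hk; rw [hT₁j]; exact Nat.le_add_right _ _
      · rw [hT₁off γ k hk]
    have hmono₁' : ∀ γ, (∏ c, (x c : E) ^ γ c) = ∏ c, (x₁ c : E) ^ T₁ γ c := fun γ => by
      rw [hT₁]; exact hmono₁ γ
    -- the new relation, its vector `c₁ = update c j (∑_J c)` and support
    have hvmono : ∀ γ, ∏ k, O.valuation (x k : E) ^ γ k =
        ∏ k, O.valuation (x₁ k : E) ^ T₁ γ k := fun γ => by
      have h := congr_arg O.valuation (hmono₁' γ)
      simpa only [map_prod, map_pow] using h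
    have hrel₁ : ∏ k, O.valuation (x₁ k : E) ^ T₁ p k =
        ∏ k, O.valuation (x₁ k : E) ^ T₁ m k := by
      rw [← hvmono p, ← hvmono m]; exact hrel
    have hc₁ : ∀ k, update c j (∑ k ∈ J, c k) k = (T₁ p k : ℤ) - T₁ m k := fun k => by
      by_cases hk : k = j
      · subst hk
        rw [update_self, hT₁j, hT₁j, ← hsumJ, ← Finset.add_sum_erase _ _ hjJ₁, hc,
          Finset.sum_congr rfl fun i _ => hc i]
        push_cast
        rw [Finset.sum_sub_distrib]
        ring
      · rw [update_of_ne hk, hT₁off p k hk, hT₁off m k hk, hc k]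
    have hcI₁ : ∀ k, k ∉ I → update c j (∑ k ∈ J, c k) k = 0 := fun k hk => by
      have hkj : k ≠ j := fun h => hk (h ▸ hjI)
      rw [update_of_ne hkj, hcI k hk]
    have hc0₁ : update c j (∑ k ∈ J, c k) ≠ 0 := by
      intro heq
      apply hc0
      have hoff : ∀ k, k ≠ j → c k = 0 := fun k hk => by
        have := congr_fun heq k
        rwa [update_of_ne hk] at this
      funext k
      by_cases hk : k = j
      · subst hk
        have h1 := congr_fun heq k
        rw [update_self, ← hsumJ, ← Finset.add_sum_erase _ _ hjJ₁,
          Finset.sum_eq_zero (fun i hi => hoff i (Finset.mem_erase.mp hi).1), add_zero] at h1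
        exact h1
      · exact hoff k hk
    -- the potential went down: induction
    have hlt_pot := hJ j hjJ
    rw [hq] at hlt_pot
    obtain ⟨t₂, ht₁t₂, ht₂, ht₂F, hTR₂, hT₂O, hreg₂, hsub₂, x₂, hspan₂, hx₂off, ⟨T₂, hT₂mono',
      hT₂le, hT₂off⟩, i, hiI, i', hi'I, hii', hvii'⟩ :=
      ih _ hlt_pot t₁ ht₁ ht₁F hTR₁ hT₁O hreg₁ x₁ hspan₁ u (hsub₁ huR) (T₁ α)
        (fun k hk => lt_of_lt_of_le (hIα k hk) (hT₁mono α k)) (by rw [hf, hmono₁' α])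
        (T₁ p) (T₁ m) (update c j (∑ k ∈ J, c k)) hc₁ hcI₁ hc0₁ hrel₁ rfl
    refine ⟨t₂, htt₁.trans ht₁t₂, ht₂, ht₂F, hTR₂, hT₂O, hreg₂, hsub₁.trans hsub₂, x₂, hspan₂,
      fun k hk => ?_, ⟨fun γ => T₂ (T₁ γ), fun γ => ?_, fun γ k => ?_, fun γ k hk => ?_⟩,
      i, hiI, i', hi'I, hii', hvii'⟩
    · have hk' : k ∉ (J ∩ I).erase j := fun h =>
        hk (Finset.mem_inter.mp (Finset.mem_erase.mp h).2).2
      rw [hx₂off k hk, hx₁off k hk']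
    · show (∏ c, (x c : E) ^ γ c) = ∏ c, (x₂ c : E) ^ T₂ (T₁ γ) c
      rw [hmono₁' γ, hT₂mono' (T₁ γ)]
    · show γ k ≤ T₂ (T₁ γ) k
      exact (hT₁mono γ k).trans (hT₂le (T₁ γ) k)
    · show T₂ (T₁ γ) k = γ k
      have hkj : k ≠ j := fun h => hk (h ▸ hjI)
      rw [hT₂off (T₁ γ) k hk, hT₁off γ k hkj]

end Perron

end Literature.AlgebraicGeometry.Resolution

end
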